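import Summits.SmoothPoincare4.SmoothPoincare4.Theses.RootDecompO

/-!
# RootDecompO — glue of the split «PresentationRank» of `PresentationSpheresStandard`

Proves the glue item `PresentationSpheresStandardGlue` (stmt-SmoothPoincare4-29164, support, rank 504) of
route-SmoothPoincare4-RootDecompO:
`PresentationRankLEOne → PresentationRankTwo → PresentationRankGEThree → PresentationSpheresStandard`
(stmt-SmoothPoincare4-29161 → 29162 → 29163 → 26154).

Pure logic (trichotomy `c ≤ 1 ∨ c = 2 ∨ 3 ≤ c` on the number `c` of index-2 critical points of the adapted Morse
function of the contractible filling `W`, `∂W = M`): the three rank cells exhaust the parent. The filling tuple is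
destructured and re-packed with the extra cardinality clause. Root decomposition cell decomp-sp4 (D-0178), LANDING LIST 2
(writer g6); 0 sorry. Nothing here proves `SmoothPoincare4`.
-/

set_option linter.dupNamespace false

open scoped Manifold ContDiff

namespace Summit.SmoothPoincare4.SmoothPoincare4.Theorems.RootDecompOPresentationSpheresStandardSplit

open Summit.SmoothPoincare4.SmoothPoincare4.Theses.RootDecompO

/-- Item stmt-SmoothPoincare4-29164: the three presentation-rank cells re-assemble the parent
`PresentationSpheresStandard`. -/
theorem presentationSpheresStandardGlue_holds : PresentationSpheresStandardGlue := by
  intro h₁ h₂ h₃ M _ _ _ _ _ e hP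
  obtain ⟨W, i₁, i₂, i₃, i₄, i₅, i₆, hW, ⟨f, hf, hidx⟩, φ, hφ, hrange⟩ := hP
  rcases Nat.lt_or_ge (Literature.Topology.FourManifolds.criticalSetOfIndex (𝓡∂ (4 + 1)) f 2).ncard 2
    with hlt | hge
  · exact h₁ M e ⟨W, i₁, i₂, i₃, i₄, i₅, i₆, hW, ⟨f, hf, by omega, hidx⟩, φ, hφ, hrange⟩
  · rcases Nat.eq_or_lt_of_le hge with heq | hgt
    · exact h₂ M e ⟨W, i₁, i₂, i₃, i₄, i₅, i₆, hW, ⟨f, hf, heq.symm, hidx⟩, φ, hφ, hrange⟩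
    · exact h₃ M e ⟨W, i₁, i₂, i₃, i₄, i₅, i₆, hW, ⟨f, hf, by omega, hidx⟩, φ, hφ, hrange⟩

end Summit.SmoothPoincare4.SmoothPoincare4.Theorems.RootDecompOPresentationSpheresStandardSplit
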